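import Summits.BirchSwinnertonDyer.BirchSwinnertonDyer.Theorems.BiquadraticEisensteinDescentHeegnerTwistCouplingInSupplySqrtTwoCellSeven
import Summits.BirchSwinnertonDyer.BirchSwinnertonDyer.Theorems.BiquadraticEisensteinDescentHeegnerTwistCouplingInSupplySqrtTwoCornerFifteenMinimal
import HarnessLib

set_option linter.dupNamespace false -- `Summit.BirchSwinnertonDyer.BirchSwinnertonDyer.Theorems.…` (summit = sub)
set_option autoImplicit false

/-!
# Crux `HeegnerTwistCouplingInSupply` (stmt-BirchSwinnertonDyer-21381) — card `sqrt2-isogeny-heegner-pin`, the `j = 8000` corner at `p ≡ 5 (mod 8)`: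
# PIN-FREE RUNGS from the third cell — `K′ = ℚ(√−ℓ₀)`, `ℓ₀ ∈ {7, 23, 71, 103, 151}` (the primes `≡ 7 (mod 16)` below `166`), covering every prime
# `p ≡ 5 (mod 8)`, `p ≠ 5`, that is a quadratic residue modulo one of them (rung `7` alone: `p ≡ 1, 2, 4 (mod 7)`), modulo Burungale–Tian + Deuring–Hecke

Route `BiquadraticEisensteinDescent` (cell `pub/bsd-wall`, width seat `bsd-wall-cm-bed-w2` g12; `--supports` 21381, helper). For `W = B_p`,
`p ≡ 5 (mod 8)`, the Heegner condition on the prime-discriminant field `K′ = ℚ(√−ℓ)` (`ℓ ≡ 7 (mod 8)`: `d_{K′} = −ℓ ≡ 1 (mod 8)`, `2` splits) is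
`(−ℓ/p) = (ℓ/p) = (p/ℓ) = +1` — EXACTLY the condition of the third cell `…SqrtTwoCellSeven` (`c = p` a square mod `ℓ`). So every FIXED prime
`ℓ₀ ≡ 7 (mod 16)` (where `x⁴ − 4x² + 2` is rootless, here by `decide`) is a rung with no pin and no size lever beyond `h(−ℓ₀) ≤ 10 < p`
(`classNumber_le_ten_of_natAbs_discr_le`, `|d| ≤ 166`): complementary to bed-w1's target T_A (`p ≡ ±2 (mod 5)`, `…SqrtTwoCorner`) and partner
ladder (`…SqrtTwoLadder*`).

* §1 ★ `cruxOnBpCornerPrime_of_two_facts` — generic rung: `p ≡ 5 (8)`, `p ≠ 5`, `ℓ ≡ 7 (8)` prime, `ℓ ≤ 166`, `x⁴ − 4x² + 2` rootless mod `ℓ`,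
  `(p/ℓ) = +1` ⇒ `K′ = ℚ(√−ℓ)` (`sqrtField (−ℓ)`): imaginary quadratic, `d = −ℓ`, `4 < |d|`, Heegner for `N(B_p)` (prime support `{2,p}`),
  `L(B_p^{(−ℓ)}, 1) = L(B_{−pℓ}, 1) ≠ 0` (third cell + `L_one_ne_zero_B_neg_of_selmerCorank`), `h(K′) < p`, `p ∤ h(K′)`;
* §2 `rootless_seven` (`decide +kernel` in `ZMod 7/23/71/103/151`), ★★ `cruxOnBpCornerRungs_of_two_facts` (the five rungs in Jacobi form),
  `cruxOnBpCornerRungSeven_of_two_facts` (rung `7` in residue form: `p ≡ 1, 2, 4 (mod 7)`, `d_{K′} = −7`), ★★ `cruxOnBpCornerFive_of_two_facts` —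
  for every prime `p ≡ 5 (mod 8)`, `p ≠ 5`, with `p ≡ ±2 (mod 5)` or `(p/ℓ₀) = +1` for some `ℓ₀ ∈ {7, 23, 71, 103, 151}`: the CONCLUSION of crux
  21381 for `W = B_p`, modulo `hBT` + `hH` only, with `[Fact p.Prime] [IsElliptic]` as the only binders (`isGloballyMinimal_B`, `neZero_conductorNorm_B`).

HONEST FRAMING: typed sub-corner theorems on ONE CM family; the residual of `p ≡ 5 (mod 8)` (primes `≡ ±1 (5)` that are non-residues mod all five
`ℓ₀` and outside bed-w1's partner ladder) stays rung-by-rung, never all `p` without a least-prime input; C⁺ untouched; crux 21381 NOT closed;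
BSD is not proved by any of this. THEOREMS ONLY; supports stmt-BirchSwinnertonDyer-21381.
-/

noncomputable section

open scoped Classical

namespace Summit.BirchSwinnertonDyer.BirchSwinnertonDyer.Theorems.BiquadraticEisensteinDescentHeegnerTwistCouplingInSupplySqrtTwoCornerSeven

open _root_.WeierstrassCurve Literature.NumberTheory.EllipticCurves
open Summit.BirchSwinnertonDyer.BirchSwinnertonDyer.Theorems.BiquadraticEisensteinDescentHeegnerTwistCouplingInSupplySqrtTwoCell (isElliptic_B)
open Summit.BirchSwinnertonDyer.BirchSwinnertonDyer.Theorems.BiquadraticEisensteinDescentHeegnerTwistCouplingInSupplySqrtTwoCellSeven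
  (selmerCorank_two_eq_zero)
open Summit.BirchSwinnertonDyer.BirchSwinnertonDyer.Theorems.BiquadraticEisensteinDescentHeegnerTwistCouplingInSupplySqrtTwoCorner
  (quadraticTwist_B eq_two_or_eq_of_prime_dvd_conductorNorm_B L_one_ne_zero_B_neg_of_selmerCorank cruxOnBpCorner_of_two_facts)
open Summit.BirchSwinnertonDyer.BirchSwinnertonDyer.Theorems.BiquadraticEisensteinDescentHeegnerTwistCouplingInSupplySqrtTwoCornerFifteenMinimal
  (isGloballyMinimal_B neZero_conductorNorm_B)
open Summit.BirchSwinnertonDyer.BirchSwinnertonDyer.Theorems.BiquadraticEisensteinDescentHeegnerTwistCouplingInSupplySizeIndivisibleSharp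
  (classNumber_le_six_of_natAbs_discr_le classNumber_le_ten_of_natAbs_discr_le)

/-! ## §1 The generic prime-twist rung -/

section Rung

/-- ★ **Generic pin-free rung.** For primes `p ≡ 5 (mod 8)`, `p ≠ 5`, and `ℓ ≡ 7 (mod 8)` with `x⁴ − 4x² + 2` rootless mod `ℓ`, `|−ℓ| ≤ 166`
and `(p/ℓ) = +1`: `K′ = ℚ(√−ℓ)` is imaginary quadratic with `d_{K′} = −ℓ ≡ 1 (mod 8)`, Heegner for `N(B_p)` (prime support `{2, p}`: `2` splits,
`(−ℓ/p) = (ℓ/p) = (p/ℓ) = +1` by reciprocity, `p ≡ 1 (mod 4)`), `h(K′) ≤ 10 < p`, and `L(B_p^{(−ℓ)}, 1) = L(B_{−pℓ}, 1) ≠ 0` by the third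
cell + Burungale–Tian + Deuring–Hecke. [cite: BurungaleTian2026, Thm. 1.1] [cite: SilvermanAEC2009, Prop. X.4.9] [cite: Cox2013, §7.B Thm. 7.7(ii)] -/
theorem cruxOnBpCornerPrime_of_two_facts (hBT : burungaleTian_analyticRank_eq_zero_of_selmerCorank_eq_zero_of_hasCM)
    (hH : hasEntireLFunction_of_j_mem_maximalCMJInvariants) {p ℓ : ℕ} (hp : p.Prime) (hp8 : p % 8 = 5) (h5 : p ≠ 5)
    (hℓ : ℓ.Prime) (hℓ8 : ℓ % 8 = 7) (hℓ166 : ℓ ≤ 166) (hroot : ∀ x : ZMod ℓ, x ^ 4 - 4 * x ^ 2 + 2 ≠ 0)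
    (hJ : jacobiSym (p : ℤ) ℓ = 1) [(⟨0, 4 * (p : ℚ), 0, 2 * (p : ℚ) ^ 2, 0⟩ : WeierstrassCurve ℚ).IsElliptic] :
    ∃ (K : Type) (_ : Field K) (_ : NumberField K),
      IsImaginaryQuadratic K ∧ NumberField.discr K = -(ℓ : ℤ) ∧ 4 < (NumberField.discr K).natAbs ∧
      SatisfiesHeegnerHypothesis ((⟨0, 4 * (p : ℚ), 0, 2 * (p : ℚ) ^ 2, 0⟩ : WeierstrassCurve ℚ).conductorNorm ℤ) K ∧
      ((⟨0, 4 * (p : ℚ), 0, 2 * (p : ℚ) ^ 2, 0⟩ : WeierstrassCurve ℚ).quadraticTwist (NumberField.discr K : ℚ)).entireLFunction 1 ≠ 0 ∧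
      NumberField.classNumber K < p ∧ ¬ p ∣ NumberField.classNumber K := by
  haveI : Fact p.Prime := ⟨hp⟩
  haveI : Fact ℓ.Prime := ⟨hℓ⟩
  haveI : Fact ((-(ℓ : ℤ)) < 0) := ⟨by have := hℓ.pos; omega⟩
  have hp13 : 13 ≤ p := by omega
  have hpl : p ≠ ℓ := by rintro rfl; omega
  have hsf : Squarefree (-(ℓ : ℤ)).natAbs := by
    rw [Int.natAbs_neg, Int.natAbs_natCast]; exact hℓ.squarefree
  have hD8 : (-(ℓ : ℤ)) % 8 = 1 := by omega
  obtain ⟨hK, hdK⟩ := isImaginaryQuadratic_and_discr_sqrtField_of_squarefree_natAbs (-(ℓ : ℤ)) (by omega) hsf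
  -- `(ℓ/p) = (p/ℓ) = +1` and `(−ℓ/p) = +1`
  have hJ' : jacobiSym (ℓ : ℤ) p = 1 := by
    rw [← jacobiSym.quadratic_reciprocity_one_mod_four (by omega) (Nat.odd_iff.mpr (by omega))]; exact hJ
  have hJneg : jacobiSym (-(ℓ : ℤ)) p = 1 := by
    rw [jacobiSym.neg _ (Nat.odd_iff.mpr (by omega)), ZMod.χ₄_nat_one_mod_four (by omega), hJ', one_mul]
  -- `p` is a square mod `ℓ`
  have hp0 : ((p : ℤ) : ZMod ℓ) ≠ 0 := by
    rw [Ne, ZMod.intCast_zmod_eq_zero_iff_dvd, Int.natCast_dvd_natCast]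
    exact fun h => hpl ((Nat.prime_dvd_prime_iff_eq hℓ hp).mp h).symm
  have hsq : IsSquare (p : ZMod ℓ) := by
    have h := (legendreSym.eq_one_iff ℓ hp0).mp (by rw [jacobiSym.legendreSym.to_jacobiSym]; exact hJ)
    simpa using h
  -- the `L`-value on the third cell
  set m : ℤ := (p : ℤ) * (ℓ : ℤ) with hm
  have hm0 : 0 < m := by have := hp.pos; have := hℓ.pos; positivity
  have htw : (⟨0, 4 * (p : ℚ), 0, 2 * (p : ℚ) ^ 2, 0⟩ : WeierstrassCurve ℚ).quadraticTwist ((-(ℓ : ℤ) : ℤ) : ℚ) =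
      ⟨0, -4 * (m : ℚ), 0, 2 * (m : ℚ) ^ 2, 0⟩ := by
    rw [quadraticTwist_B, hm]; push_cast; ext <;> simp
  haveI := isElliptic_B hm0.ne'
  have hL := (L_one_ne_zero_B_neg_of_selmerCorank hBT hH hm0.ne'
    (selmerCorank_two_eq_zero hp hp8 hℓ hℓ8 hroot hsq hm)).2
  refine ⟨sqrtField (-(ℓ : ℤ)), inferInstance, inferInstance, hK, hdK, ?_, ?_, ?_, ?_, ?_⟩
  · rw [hdK, Int.natAbs_neg, Int.natAbs_natCast]; omega
  · refine satisfiesHeegnerHypothesis_sqrtField_of_squarefree_natAbs _ hD8 hsf fun q hq hqN => ?_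
    rcases eq_two_or_eq_of_prime_dvd_conductorNorm_B hp hq hqN with rfl | rfl
    · exact Or.inl rfl
    · exact Or.inr hJneg
  · rw [hdK, htw]; exact hL
  · refine (classNumber_le_ten_of_natAbs_discr_le hK ?_).trans_lt (by omega)
    rw [hdK, Int.natAbs_neg, Int.natAbs_natCast]; exact hℓ166
  · intro hdvd
    have h10 : NumberField.classNumber (sqrtField (-(ℓ : ℤ))) ≤ 10 :=
      classNumber_le_ten_of_natAbs_discr_le hK (by rw [hdK, Int.natAbs_neg, Int.natAbs_natCast]; exact hℓ166)
    exact absurd (Nat.le_of_dvd (NumberField.classNumber_pos _) hdvd) (by omega)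

end Rung

/-! ## §2 The rungs `ℓ₀ ∈ {7, 23, 71, 103, 151}` (the primes `≡ 7 (mod 16)` with `ℓ₀ ≤ 166`; rootlessness by `decide`) -/

section Rungs

/-- `x⁴ − 4x² + 2` has no root modulo `7, 23, 71, 103, 151` (the primes `≡ 7 (mod 16)` below `166`; `2 ± √2` are non-squares there).
[folklore] -/
theorem rootless_seven : (∀ x : ZMod 7, x ^ 4 - 4 * x ^ 2 + 2 ≠ 0) ∧ (∀ x : ZMod 23, x ^ 4 - 4 * x ^ 2 + 2 ≠ 0) ∧
    (∀ x : ZMod 71, x ^ 4 - 4 * x ^ 2 + 2 ≠ 0) ∧ (∀ x : ZMod 103, x ^ 4 - 4 * x ^ 2 + 2 ≠ 0) ∧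
    (∀ x : ZMod 151, x ^ 4 - 4 * x ^ 2 + 2 ≠ 0) := by
  refine ⟨by decide +kernel, by decide +kernel, by decide +kernel, by decide +kernel, by decide +kernel⟩

/-- ★★ **The pin-free rungs of the `j = 8000` corner at `p ≡ 5 (mod 8)`.** For every prime `p ≡ 5 (mod 8)`, `p ≠ 5`, which is a quadratic
residue modulo some `ℓ₀ ∈ {7, 23, 71, 103, 151}`: the conclusion of crux `HeegnerTwistCouplingInSupply` holds for `W = B_p : y² = x³ + 4px² + 2p²x`
with the EXPLICIT field `K′ = ℚ(√−ℓ₀)` (`h = 1, 3, 7, 5, 7`) — modulo Burungale–Tian + Deuring–Hecke only. Rung `7` alone is every prime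
`p ≡ 5 (mod 8)` with `p ≡ 1, 2, 4 (mod 7)`. The binders `IsGloballyMinimal`, `NeZero N` mirror the crux and are unused.
[cite: BurungaleTian2026, Thm. 1.1] [cite: SilvermanAEC2009, Prop. X.4.9] [cite: Cox2013, §7.B Thm. 7.7(ii)] -/
theorem cruxOnBpCornerRungs_of_two_facts (hBT : burungaleTian_analyticRank_eq_zero_of_selmerCorank_eq_zero_of_hasCM)
    (hH : hasEntireLFunction_of_j_mem_maximalCMJInvariants) :
    ∀ (p : ℕ) [Fact p.Prime] [(⟨0, 4 * (p : ℚ), 0, 2 * (p : ℚ) ^ 2, 0⟩ : WeierstrassCurve ℚ).IsElliptic]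
      [(⟨0, 4 * (p : ℚ), 0, 2 * (p : ℚ) ^ 2, 0⟩ : WeierstrassCurve ℚ).IsGloballyMinimal]
      [NeZero ((⟨0, 4 * (p : ℚ), 0, 2 * (p : ℚ) ^ 2, 0⟩ : WeierstrassCurve ℚ).conductorNorm ℤ)],
      p % 8 = 5 → p ≠ 5 →
      (jacobiSym (p : ℤ) 7 = 1 ∨ jacobiSym (p : ℤ) 23 = 1 ∨ jacobiSym (p : ℤ) 71 = 1 ∨ jacobiSym (p : ℤ) 103 = 1 ∨
        jacobiSym (p : ℤ) 151 = 1) →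
      ∃ (K : Type) (_ : Field K) (_ : NumberField K),
        IsImaginaryQuadratic K ∧ 4 < (NumberField.discr K).natAbs ∧
        SatisfiesHeegnerHypothesis ((⟨0, 4 * (p : ℚ), 0, 2 * (p : ℚ) ^ 2, 0⟩ : WeierstrassCurve ℚ).conductorNorm ℤ) K ∧
        ((⟨0, 4 * (p : ℚ), 0, 2 * (p : ℚ) ^ 2, 0⟩ : WeierstrassCurve ℚ).quadraticTwist (NumberField.discr K : ℚ)).entireLFunction 1 ≠ 0 ∧
        NumberField.classNumber K < p ∧ ¬ p ∣ NumberField.classNumber K := by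
  intro p hpF _ _ _ hp8 h5 hJ
  have hp : p.Prime := hpF.out
  obtain ⟨h7, h23, h71, h103, h151⟩ := rootless_seven
  rcases hJ with hJ | hJ | hJ | hJ | hJ
  · obtain ⟨K, iF, iN, hK, -, h4, hHg, hL, hcl, hnd⟩ :=
      cruxOnBpCornerPrime_of_two_facts hBT hH hp hp8 h5 (by norm_num) (by norm_num) (by norm_num) h7 hJ
    exact ⟨K, iF, iN, hK, h4, hHg, hL, hcl, hnd⟩
  · obtain ⟨K, iF, iN, hK, -, h4, hHg, hL, hcl, hnd⟩ :=
      cruxOnBpCornerPrime_of_two_facts hBT hH hp hp8 h5 (by norm_num) (by norm_num) (by norm_num) h23 hJ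
    exact ⟨K, iF, iN, hK, h4, hHg, hL, hcl, hnd⟩
  · obtain ⟨K, iF, iN, hK, -, h4, hHg, hL, hcl, hnd⟩ :=
      cruxOnBpCornerPrime_of_two_facts hBT hH hp hp8 h5 (by norm_num) (by norm_num) (by norm_num) h71 hJ
    exact ⟨K, iF, iN, hK, h4, hHg, hL, hcl, hnd⟩
  · obtain ⟨K, iF, iN, hK, -, h4, hHg, hL, hcl, hnd⟩ :=
      cruxOnBpCornerPrime_of_two_facts hBT hH hp hp8 h5 (by norm_num) (by norm_num) (by norm_num) h103 hJ
    exact ⟨K, iF, iN, hK, h4, hHg, hL, hcl, hnd⟩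
  · obtain ⟨K, iF, iN, hK, -, h4, hHg, hL, hcl, hnd⟩ :=
      cruxOnBpCornerPrime_of_two_facts hBT hH hp hp8 h5 (by norm_num) (by norm_num) (by norm_num) h151 hJ
    exact ⟨K, iF, iN, hK, h4, hHg, hL, hcl, hnd⟩

/-- **Rung `7` in residue form**: every prime `p ≡ 5 (mod 8)` with `p ≡ 1, 2, 4 (mod 7)` (half of the class `p ≡ 5 (mod 8)`), `K′ = ℚ(√−7)`.
[cite: BurungaleTian2026, Thm. 1.1] [cite: SilvermanAEC2009, Prop. X.4.9] -/
theorem cruxOnBpCornerRungSeven_of_two_facts (hBT : burungaleTian_analyticRank_eq_zero_of_selmerCorank_eq_zero_of_hasCM)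
    (hH : hasEntireLFunction_of_j_mem_maximalCMJInvariants) :
    ∀ (p : ℕ) [Fact p.Prime] [(⟨0, 4 * (p : ℚ), 0, 2 * (p : ℚ) ^ 2, 0⟩ : WeierstrassCurve ℚ).IsElliptic],
      p % 8 = 5 → (p % 7 = 1 ∨ p % 7 = 2 ∨ p % 7 = 4) →
      ∃ (K : Type) (_ : Field K) (_ : NumberField K),
        IsImaginaryQuadratic K ∧ NumberField.discr K = -7 ∧
        SatisfiesHeegnerHypothesis ((⟨0, 4 * (p : ℚ), 0, 2 * (p : ℚ) ^ 2, 0⟩ : WeierstrassCurve ℚ).conductorNorm ℤ) K ∧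
        ((⟨0, 4 * (p : ℚ), 0, 2 * (p : ℚ) ^ 2, 0⟩ : WeierstrassCurve ℚ).quadraticTwist (NumberField.discr K : ℚ)).entireLFunction 1 ≠ 0 ∧
        NumberField.classNumber K < p ∧ ¬ p ∣ NumberField.classNumber K := by
  intro p hpF _ hp8 hp7
  have hp : p.Prime := hpF.out
  have hJ : jacobiSym (p : ℤ) 7 = 1 := by
    rw [jacobiSym.mod_left (p : ℤ) 7]
    rcases hp7 with h | h | h
    · rw [show (p : ℤ) % (7 : ℕ) = 1 by omega]; exact jacobiSym.one_left 7
    · rw [show (p : ℤ) % (7 : ℕ) = 2 by omega]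
      rw [jacobiSym.at_two (by decide : Odd 7), ZMod.χ₈_nat_eq_if_mod_eight]; decide
    · rw [show (p : ℤ) % (7 : ℕ) = 4 by omega, show (4 : ℤ) = 2 ^ 2 by norm_num]
      exact jacobiSym.sq_one' (by decide)
  obtain ⟨K, iF, iN, hK, hdK, -, hHg, hL, hcl, hnd⟩ :=
    cruxOnBpCornerPrime_of_two_facts hBT hH hp hp8 (by rintro rfl; omega) (by norm_num) (by norm_num) (by norm_num)
      rootless_seven.1 hJ
  exact ⟨K, iF, iN, hK, by rw [hdK]; norm_num, hHg, hL, hcl, hnd⟩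

/-- ★★ **The `j = 8000` corner at `p ≡ 5 (mod 8)`, union of the pin-free rungs with bed-w1's target T_A** (`…SqrtTwoCorner.cruxOnBpCorner_of_two_facts`,
`p ≡ ±2 (mod 5)`): the crux conclusion for `W = B_p` for every prime `p ≡ 5 (mod 8)` (`p ≠ 5`) with `p ≡ ±2 (mod 5)` or `p` a quadratic residue modulo one
of `7, 23, 71, 103, 151`, modulo Burungale–Tian + Deuring–Hecke only; instance binders as in the crux, discharged for `W = B_p` by
`…CornerFifteenMinimal.isGloballyMinimal_B` / `neZero_conductorNorm_B` except `[IsElliptic]`. HONEST FRAMING: a sub-corner of one CM family;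
crux 21381 is NOT closed; BSD is not proved by this. [cite: BurungaleTian2026, Thm. 1.1] [cite: SilvermanAEC2009, Prop. X.4.9] -/
theorem cruxOnBpCornerFive_of_two_facts (hBT : burungaleTian_analyticRank_eq_zero_of_selmerCorank_eq_zero_of_hasCM)
    (hH : hasEntireLFunction_of_j_mem_maximalCMJInvariants) :
    ∀ (p : ℕ) [Fact p.Prime] [(⟨0, 4 * (p : ℚ), 0, 2 * (p : ℚ) ^ 2, 0⟩ : WeierstrassCurve ℚ).IsElliptic], p % 8 = 5 → p ≠ 5 →
      (p % 5 = 2 ∨ p % 5 = 3 ∨ jacobiSym (p : ℤ) 7 = 1 ∨ jacobiSym (p : ℤ) 23 = 1 ∨ jacobiSym (p : ℤ) 71 = 1 ∨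
        jacobiSym (p : ℤ) 103 = 1 ∨ jacobiSym (p : ℤ) 151 = 1) →
      ∃ (K : Type) (_ : Field K) (_ : NumberField K),
        IsImaginaryQuadratic K ∧ 4 < (NumberField.discr K).natAbs ∧
        SatisfiesHeegnerHypothesis ((⟨0, 4 * (p : ℚ), 0, 2 * (p : ℚ) ^ 2, 0⟩ : WeierstrassCurve ℚ).conductorNorm ℤ) K ∧
        ((⟨0, 4 * (p : ℚ), 0, 2 * (p : ℚ) ^ 2, 0⟩ : WeierstrassCurve ℚ).quadraticTwist (NumberField.discr K : ℚ)).entireLFunction 1 ≠ 0 ∧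
        NumberField.classNumber K < p ∧ ¬ p ∣ NumberField.classNumber K := by
  intro p hpF _ hp8 hne5 h
  haveI := isGloballyMinimal_B hpF.out (by rintro rfl; omega)
  haveI := neZero_conductorNorm_B p
  rcases h with h5 | h5 | hJ
  · exact cruxOnBpCorner_of_two_facts hBT hH p hp8 (Or.inl h5)
  · exact cruxOnBpCorner_of_two_facts hBT hH p hp8 (Or.inr h5)
  · exact cruxOnBpCornerRungs_of_two_facts hBT hH p hp8 hne5 hJ

end Rungs

end Summit.BirchSwinnertonDyer.BirchSwinnertonDyer.Theorems.BiquadraticEisensteinDescentHeegnerTwistCouplingInSupplySqrtTwoCornerSeven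

end
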